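import Summits.KontsevichZagierPeriods.KontsevichZagierPeriods.Theorems.RootDecompWalshStrataBall4Band

/-!
# The paraboloid specimen, part 1/3: `[(0,1)⁴ ∩ {x₃ > x₀² + x₁² + x₂²}, q] ≡ [B³₊, q(1 − |u|²)]`

Route `RootDecompWalshStrata` (cell decomp-kz, lens 4, gen 11), support toward `QuadricSignKernel`
(item stmt-KontsevichZagierPeriods-25393), slice `d = 4`: a SECOND instance of the `d = 4` quadric descent
`QuadricTwoDescentFour`, of a different affine type (rank-3 quadratic part plus a linear term: the solid
paraboloid `x₃ > x₀² + x₁² + x₂²` in the unit 4-cube; value `q·π/15`).  This part: the cell is the open band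
`|u|² < x₃ < 1` over the orthant of the unit 3-ball `B³₊ = (0,1)³ ∩ {1 − u₀² − u₁² − u₂² > 0}`
(`mem_cell_iff_init`), so Newton–Leibniz along `x₃` with the primitive `q·x₃` (rule (3), LOWER edge the
polynomial `|u|²`, upper edge `1`) and opening the fibres (rule (1a)) give
`of_cell_sub_of_b3WRep_mem_relations q : [cell, q] − [B³₊, q(1 − u₀² − u₁² − u₂²)] ∈ KZ.relations`
— a POLYNOMIAL weight on a quadric 3-cell.  0 sorry.  [KontsevichZagier2001 §1.2 rules (1), (3)]
-/

noncomputable section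

open Literature.NumberTheory.Transcendental
open MeasureTheory Set
open MvPolynomial (aeval X C)
open Literature.ModelTheory.ExponentialFields (IsSemialgebraic isSemialgebraic_setOf_eval_pos
  isSemialgebraic_setOf_eval_lt continuous_aeval_real)
open Summit.KontsevichZagierPeriods.RootDecompWalshStrata.WalshSpanProof (isSemialgebraic_cubeSet
  isBounded_cubeSet cellRep cellRep_domain cellRep_integrand)

namespace Summit.KontsevichZagierPeriods.RootDecompWalshStrata.Parab4

/-! #### The polynomials and the base cell `B³₊` -/

/-- The solid paraboloid `x₃ − x₀² − x₁² − x₂²` in four variables. -/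
def parab4Poly : MvPolynomial (Fin 4) ℚ := X 3 - X 0 ^ 2 - X 1 ^ 2 - X 2 ^ 2

/-- Evaluation of the paraboloid polynomial. [definition] -/
@[simp] theorem aeval_parab4Poly (x : Fin 4 → ℝ) :
    aeval x parab4Poly = x 3 - x 0 ^ 2 - x 1 ^ 2 - x 2 ^ 2 := by
  simp [parab4Poly]

/-- The unit 3-ball polynomial `1 − u₀² − u₁² − u₂²`. -/
def ball3Poly : MvPolynomial (Fin 3) ℚ := 1 - X 0 ^ 2 - X 1 ^ 2 - X 2 ^ 2

/-- Evaluation of the 3-ball polynomial. [definition] -/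
@[simp] theorem aeval_ball3Poly (u : Fin 3 → ℝ) :
    aeval u ball3Poly = 1 - u 0 ^ 2 - u 1 ^ 2 - u 2 ^ 2 := by
  simp [ball3Poly]

/-- The orthant of the unit 3-ball as a Walsh cell: `B³₊ = (0,1)³ ∩ {ball3Poly > 0}`. -/
def b3Set : Set (Fin 3 → ℝ) := {u | (∀ j, 0 < u j ∧ u j < 1) ∧ 0 < aeval u ball3Poly}

/-- `B³₊` is `ℚ`-semialgebraic. [BCR1998 §2.1] -/
theorem isSemialgebraic_b3Set : IsSemialgebraic ℚ b3Set := (cellRep ball3Poly 0).isSemialgebraic_domain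

/-- `B³₊ ⊆ [0,1]³`. [folklore] -/
theorem b3Set_subset_Icc : b3Set ⊆ Icc 0 1 := fun _ hu => ⟨fun j => (hu.1 j).1.le, fun j => (hu.1 j).2.le⟩

/-- `[B³₊, q(1 − u₀² − u₁² − u₂²)]`: the descended representation, a POLYNOMIAL weight on the 3-ball
orthant. [KontsevichZagier2001 §1.1] -/
def b3WRep (q : ℚ) : KZ.IntegralRep 3 where
  domain := b3Set
  integrand u := (q : ℝ) * (1 - u 0 ^ 2 - u 1 ^ 2 - u 2 ^ 2)
  isSemialgebraic_domain := isSemialgebraic_b3Set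
  isSemialgebraicFunOn_integrand :=
    (isSemialgebraicFunOn_aeval isSemialgebraic_b3Set (C q * (1 - X 0 ^ 2 - X 1 ^ 2 - X 2 ^ 2))).congr
      fun u _ => by simp
  integrableOn := by
    refine (ContinuousOn.integrableOn_compact isCompact_Icc ?_).mono_set b3Set_subset_Icc
    exact (continuous_const.mul (((continuous_const.sub ((continuous_apply 0).pow 2)).sub
      ((continuous_apply 1).pow 2)).sub ((continuous_apply 2).pow 2))).continuousOn

/-- The domain of the descended representation. [definition] -/
@[simp] theorem b3WRep_domain (q : ℚ) : (b3WRep q).domain = b3Set := rfl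

/-- The integrand of the descended representation. [definition] -/
@[simp] theorem b3WRep_integrand (q : ℚ) (u : Fin 3 → ℝ) :
    (b3WRep q).integrand u = (q : ℝ) * (1 - u 0 ^ 2 - u 1 ^ 2 - u 2 ^ 2) := rfl

/-! #### The cell is the open band `|u|² < x₃ < 1` over `B³₊` -/

/-- The lower edge `a(u) = u₀² + u₁² + u₂²` of the band. -/
def loEdge (u : Fin 3 → ℝ) : ℝ := u 0 ^ 2 + u 1 ^ 2 + u 2 ^ 2

/-- The lower edge is `ℚ`-semialgebraic (a polynomial). [BCR1998 §2.2] -/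
theorem isSemialgebraicFunOn_loEdge : IsSemialgebraicFunOn ℚ b3Set loEdge :=
  (isSemialgebraicFunOn_aeval isSemialgebraic_b3Set (X 0 ^ 2 + X 1 ^ 2 + X 2 ^ 2)).congr fun u _ => by
    simp [loEdge]

/-- Coordinates of `Fin.snoc` on `ℝ³ × ℝ`. [definition] -/
@[simp] theorem snoc₃_apply (u : Fin 3 → ℝ) (s : ℝ) :
    (Fin.snoc u s : Fin 4 → ℝ) 3 = s ∧ (Fin.snoc u s : Fin 4 → ℝ) 0 = u 0 ∧
      (Fin.snoc u s : Fin 4 → ℝ) 1 = u 1 ∧ (Fin.snoc u s : Fin 4 → ℝ) 2 = u 2 := ⟨rfl, rfl, rfl, rfl⟩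

/-- Membership in the paraboloid cell in band form: the cell is the open band `a(u) < x₃ < 1` over
`B³₊`. [folklore] -/
theorem mem_cell_iff_init (q : ℚ) (x : Fin 4 → ℝ) :
    x ∈ (cellRep parab4Poly q).domain ↔
      Fin.init x ∈ b3Set ∧ loEdge (Fin.init x) < x (Fin.last 3) ∧ x (Fin.last 3) < 1 := by
  rw [cellRep_domain]
  have hb3 : Fin.init x ∈ b3Set ↔
      ((0 < x 0 ∧ x 0 < 1) ∧ (0 < x 1 ∧ x 1 < 1) ∧ (0 < x 2 ∧ x 2 < 1)) ∧
        0 < 1 - x 0 ^ 2 - x 1 ^ 2 - x 2 ^ 2 := by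
    simp only [b3Set, mem_setOf_eq, aeval_ball3Poly, Fin.init]
    exact ⟨fun ⟨hu, hc⟩ => ⟨⟨hu 0, hu 1, hu 2⟩, hc⟩, fun ⟨⟨h0, h1, h2⟩, hc⟩ =>
      ⟨fun j => by fin_cases j <;> assumption, hc⟩⟩
  have hcube : (∀ j : Fin 4, 0 < x j ∧ x j < 1) ↔
      (0 < x 0 ∧ x 0 < 1) ∧ (0 < x 1 ∧ x 1 < 1) ∧ (0 < x 2 ∧ x 2 < 1) ∧ (0 < x 3 ∧ x 3 < 1) :=
    ⟨fun h => ⟨h 0, h 1, h 2, h 3⟩, fun ⟨h0, h1, h2, h3⟩ j => by fin_cases j <;> assumption⟩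
  have ha : loEdge (Fin.init x) = x 0 ^ 2 + x 1 ^ 2 + x 2 ^ 2 := rfl
  have hl : x (Fin.last 3) = x 3 := rfl
  simp only [mem_setOf_eq, aeval_parab4Poly]
  rw [hcube, hb3, ha, hl]
  constructor
  · rintro ⟨⟨h0, h1, h2, h3⟩, hP⟩
    exact ⟨⟨⟨h0, h1, h2⟩, by linarith [h3.2]⟩, by linarith, h3.2⟩
  · rintro ⟨⟨⟨h0, h1, h2⟩, _⟩, hlo, h3⟩
    have hx3 : 0 < x 3 := by nlinarith [sq_nonneg (x 0), sq_nonneg (x 1), sq_nonneg (x 2)]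
    exact ⟨⟨h0, h1, h2, hx3, h3⟩, by linarith⟩

/-- The closed band `a(u) ≤ x₃ ≤ 1` over `B³₊` lies in `[0,1]⁴`. [folklore] -/
theorem band_b3Set_subset_Icc : KZlog.band b3Set loEdge (fun _ => (1:ℝ)) ⊆ Icc 0 1 := by
  intro x hx
  rw [KZlog.mem_band] at hx
  obtain ⟨hu, h0, h1⟩ := hx
  have hu' := hu.1
  have hlo : 0 ≤ loEdge (Fin.init x) := by
    simp only [loEdge]
    positivity
  refine ⟨fun j => ?_, fun j => ?_⟩
  · fin_cases j
    · exact (hu' 0).1.le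
    · exact (hu' 1).1.le
    · exact (hu' 2).1.le
    · exact hlo.trans h0
  · fin_cases j
    · exact (hu' 0).2.le
    · exact (hu' 1).2.le
    · exact (hu' 2).2.le
    · exact h1

/-! #### Moves (3) + (1a): `[cell, q] ≡ [B³₊, q(1 − |u|²)]` -/

/-- **Moves (3) + (1a):** Newton–Leibniz along `x₃` with the primitive `q·x₃` over `B³₊` (closed
fibres `[|u|², 1]`), then opening the fibres:
`[(0,1)⁴ ∩ {x₃ > |u|²}, q] − [B³₊, q(1 − u₀² − u₁² − u₂²)] ∈ KZ.relations` (`4 → 3`).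
[KontsevichZagier2001 §1.2 rules (1), (3); this node] -/
theorem of_cell_sub_of_b3WRep_mem_relations (q : ℚ) :
    KZ.of (cellRep parab4Poly q) - KZ.of (b3WRep q) ∈ KZ.relations := by
  have hBs := isSemialgebraic_b3Set
  have ha : IsSemialgebraicFunOn ℚ b3Set loEdge := isSemialgebraicFunOn_loEdge
  have hb : IsSemialgebraicFunOn ℚ b3Set (fun _ => (1:ℝ)) := by
    simpa using isSemialgebraicFunOn_ratCast hBs 1
  have hab : ∀ u ∈ b3Set, loEdge u ≤ (fun _ => (1:ℝ)) u := fun u hu => by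
    have h := hu.2
    simp only [aeval_ball3Poly] at h
    simp only [loEdge]
    linarith
  have hband : IsSemialgebraic ℚ (KZlog.band b3Set loEdge (fun _ => (1:ℝ))) :=
    KZlog.isSemialgebraic_band ha hb
  have hbdry : ∀ u ∈ b3Set,
      (q : ℝ) * (Fin.snoc u ((fun _ => (1:ℝ)) u) : Fin 4 → ℝ) 3 -
        (q : ℝ) * (Fin.snoc u (loEdge u) : Fin 4 → ℝ) 3 = (b3WRep q).integrand u := by
    intro u _
    simp only [snoc₃_apply, b3WRep_integrand, loEdge]
    ring
  obtain ⟨rb, rd, hrbd, hrbi, hrdd, hrdi, hrel⟩ := KZ.exists_band_newtonLeibniz hBs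
    loEdge (fun _ => (1:ℝ)) ha hb hab
    (fun x => (q : ℝ) * x 3) (fun _ => (q : ℝ))
    ((isSemialgebraicFunOn_aeval hband (C q * X 3)).congr fun x _ => by simp)
    (by simpa using isSemialgebraicFunOn_ratCast hband q)
    (fun u _ => by
      simp only [snoc₃_apply]
      exact (continuous_const.mul continuous_id).continuousOn)
    (fun u _ s _ => by
      simp only [snoc₃_apply]
      exact ((hasDerivAt_id s).const_mul (q : ℝ)).congr_deriv (mul_one _))
    ((continuous_const.continuousOn.integrableOn_compact isCompact_Icc).mono_set
      band_b3Set_subset_Icc)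
    ((b3WRep q).isSemialgebraicFunOn_integrand.congr fun u hu => (hbdry u hu).symm)
    (((b3WRep q).integrableOn.congr_fun (fun u hu => (hbdry u hu).symm)
      isSemialgebraic_b3Set.measurableSet_holds))
  obtain ⟨rb', hrb'd, hrb'i, hrel'⟩ := KZ.of_sub_of_restrict_openBand_mem_relations ha hb rb hrbd
  have hpin1 : KZ.of rb' - KZ.of (cellRep parab4Poly q) ∈ KZ.relations := by
    refine KZ.of_sub_of_mem_relations_of_eqOn ?_ fun x _ => ?_
    · rw [hrb'd]
      ext x
      exact mem_cell_iff_init q x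
    · rw [hrb'i, hrbi, cellRep_integrand]
  have hpin2 : KZ.of rd - KZ.of (b3WRep q) ∈ KZ.relations := by
    refine KZ.of_sub_of_mem_relations_of_eqOn ?_ fun u hu => ?_
    · rw [b3WRep_domain, hrdd]
    · rw [hrdi]
      rw [hrdd] at hu
      exact hbdry u hu
  have : KZ.of (cellRep parab4Poly q) - KZ.of (b3WRep q) =
      (KZ.of rb - KZ.of rd) - (KZ.of rb - KZ.of rb') - (KZ.of rb' - KZ.of (cellRep parab4Poly q)) +
        (KZ.of rd - KZ.of (b3WRep q)) := by abel
  rw [this]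
  exact add_mem (sub_mem (sub_mem hrel hrel') hpin1) hpin2

end Summit.KontsevichZagierPeriods.RootDecompWalshStrata.Parab4

end
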